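import Summits.Ventures.Crystal3D.Bulk.GapHullRotation
import Literature.Geometry.DiscreteGeometry.SphericalPolygonArea
import HarnessLib

/-!
# Tight triangles are FACETS of the hull of the thirteen directions: the x-triangle and the
# p-triangle are fan triangles (`phase2/LEAN-FACES-DESIGN.md` (F3): faces vs. Delaunay triangles)

HONEST FRAMING. Part of the venture `Summits/Ventures/Crystal3D` (cell `pub-crystal3d`, phase 2;
seat typer-bulk-2). Kernel theorems about ONE admissible fourteen-ball configuration `c`
(`IsGapConfig c`); nothing here asserts anything about GAP(1.26). The Literature's fan
triangulation `fanTriSets X` of `conv X` (`KissingFanTriangleSets`) triangulates each facet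
(`IsFacetNormal`, `tightSet`, `ConvexHullFacets`) from an apex; a facet with exactly three
vertices is therefore itself a fan triangle (`mem_fanTriSets_of_card_tightSet_eq_three`). For the
directions `u_j = gapDir c j` of an admissible configuration:

* **`IsGapConfig.xTriangle_mem_fanTriSets`** (`D < 4/3`) — three pairwise touching SHELL balls
  `i, j, k` give a facet `{u_i, u_j, u_k}` of `conv (dirSet c)` with normal `(u_i + u_j + u_k)/2`
  (every other direction has `⟪n, ·⟫ ≤ 3/4`, the hole direction `≤ 3D/4 < 1`), hence a fan
  triangle;
* **`IsGapConfig.pTriangle_mem_fanTriSets`** (`D < 3/2`) — two touching shell balls `i, j` both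
  touching the intruder give a facet `{p, u_i, u_j}` (normal `α (u_i + u_j) + β p`,
  `α = (1 − t)/(3/2 − 2t²)`, `β = (3/2 − 2t)/(3/2 − 2t²)`, `t = D/2`), hence a fan triangle.

Consequence (next file, with the faces-ARE-regions count `#faceTris F + 2 = #F + 2·#rattlers`):
a triangular oriented face of the tight map is exactly one fan triangle and contains no rattler.
-/

noncomputable section

namespace Summit.Ventures.Crystal3D

open Literature.Geometry.DiscreteGeometry Finset
open scoped InnerProductSpace

/-! ## A facet with three vertices is a fan triangle -/

section Generic

variable {X : Finset (EuclideanSpace ℝ (Fin 3))}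

/-- **A triangular facet is a fan triangle**: if `n` is a facet normal of `conv X` whose tight set
has exactly three points, that tight set belongs to `fanTriSets X`. -/
theorem mem_fanTriSets_of_card_tightSet_eq_three (hX1 : ∀ y ∈ X, ‖y‖ = 1)
    {n : EuclideanSpace ℝ (Fin 3)} (hn : IsFacetNormal X n) (h3 : (tightSet X n).card = 3) :
    tightSet X n ∈ fanTriSets X := by
  have hp : (n, 0) ∈ fanTriangles X := mem_fanTriangles.2 ⟨mem_facetNormals.2 hn, by simp [h3]⟩
  refine mem_fanTriSets.2 ⟨(n, 0), hp, ?_⟩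
  exact eq_of_subset_of_card_le (fanVerts_subset_tightSet hX1 hp)
    (by rw [h3, fanVerts_card hX1 hp])

/-- Three vectors with `orient3 ≠ 0` span `ℝ³`. -/
theorem span_triple_eq_top_of_orient3_ne_zero {a b d : EuclideanSpace ℝ (Fin 3)}
    (h : orient3 a b d ≠ 0) :
    Submodule.span ℝ ({a, b, d} : Set (EuclideanSpace ℝ (Fin 3))) = ⊤ := by
  have hli : LinearIndependent ℝ ![a, b, d] := linearIndependent_of_orient3_ne_zero h
  have htop := hli.span_eq_top_of_card_eq_finrank (by simp)
  have hrange : Set.range ![a, b, d] = ({a, b, d} : Set (EuclideanSpace ℝ (Fin 3))) := by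
    ext x
    simp only [Set.mem_range, Set.mem_insert_iff, Set.mem_singleton_iff]
    constructor
    · rintro ⟨i, rfl⟩
      fin_cases i <;> simp
    · rintro (rfl | rfl | rfl)
      · exact ⟨0, rfl⟩
      · exact ⟨1, rfl⟩
      · exact ⟨2, rfl⟩
  rw [← hrange, htop]

end Generic

/-! ## The two tight triangles of a gap configuration -/

section Config

variable {c : Fin 14 → EuclideanSpace ℝ (Fin 3)}

/-- Gram form of `orient3²` for unit vectors. -/
theorem orient3_sq_of_unit {a b d : EuclideanSpace ℝ (Fin 3)} (ha : ‖a‖ = 1) (hb : ‖b‖ = 1)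
    (hd : ‖d‖ = 1) :
    orient3 a b d ^ 2 = 1 + 2 * ⟪a, b⟫_ℝ * ⟪b, d⟫_ℝ * ⟪d, a⟫_ℝ - ⟪b, d⟫_ℝ ^ 2 - ⟪a, d⟫_ℝ ^ 2
      - ⟪a, b⟫_ℝ ^ 2 := by
  have haa : ⟪a, a⟫_ℝ = 1 := by rw [real_inner_self_eq_norm_sq, ha, one_pow]
  have hbb : ⟪b, b⟫_ℝ = 1 := by rw [real_inner_self_eq_norm_sq, hb, one_pow]
  have hdd : ⟪d, d⟫_ℝ = 1 := by rw [real_inner_self_eq_norm_sq, hd, one_pow]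
  rw [orient3_sq_eq_gram, haa, hbb, hdd]
  ring

/-- The tight set of a functional on the direction set, read on indices. -/
theorem mem_tightSet_dirSet_iff {n y : EuclideanSpace ℝ (Fin 3)} :
    y ∈ tightSet (dirSet c) n ↔ ∃ j : Fin 14, j ≠ 0 ∧ gapDir c j = y ∧ ⟪n, gapDir c j⟫_ℝ = 1 := by
  rw [mem_tightSet, mem_dirSet]
  constructor
  · rintro ⟨⟨j, hj0, rfl⟩, h1⟩; exact ⟨j, hj0, rfl, h1⟩
  · rintro ⟨j, hj0, rfl, h1⟩; exact ⟨⟨j, hj0, rfl⟩, h1⟩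

/-- **The x-triangle is a facet, hence a fan triangle** (`D < 4/3`): for three distinct shell
balls `i, j, k` touching pairwise, `{u_i, u_j, u_k} ∈ fanTriSets (dirSet c)`. -/
theorem IsGapConfig.xTriangle_mem_fanTriSets (hc : IsGapConfig c) (hD : intruderDist c < 4 / 3)
    {i j k : Fin 14} (hi0 : i ≠ 0) (hi13 : i ≠ 13) (hj0 : j ≠ 0) (hj13 : j ≠ 13) (hk0 : k ≠ 0)
    (hk13 : k ≠ 13) (hij : dist (c i) (c j) = 1) (hik : dist (c i) (c k) = 1)
    (hjk : dist (c j) (c k) = 1) :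
    ({gapDir c i, gapDir c j, gapDir c k} : Finset (EuclideanSpace ℝ (Fin 3))) ∈
      fanTriSets (dirSet c) := by
  have hX1 := hc.norm_of_mem_dirSet
  -- the three inner products are `1/2`
  have eij : ⟪gapDir c i, gapDir c j⟫_ℝ = 1 / 2 := by
    rw [hc.inner_gapDir_eq hi0 hj0 hij, tightLevel_of_ne hi13 hj13]
  have eik : ⟪gapDir c i, gapDir c k⟫_ℝ = 1 / 2 := by
    rw [hc.inner_gapDir_eq hi0 hk0 hik, tightLevel_of_ne hi13 hk13]
  have ejk : ⟪gapDir c j, gapDir c k⟫_ℝ = 1 / 2 := by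
    rw [hc.inner_gapDir_eq hj0 hk0 hjk, tightLevel_of_ne hj13 hk13]
  have eji : ⟪gapDir c j, gapDir c i⟫_ℝ = 1 / 2 := by rw [real_inner_comm]; exact eij
  have eki : ⟪gapDir c k, gapDir c i⟫_ℝ = 1 / 2 := by rw [real_inner_comm]; exact eik
  have ekj : ⟪gapDir c k, gapDir c j⟫_ℝ = 1 / 2 := by rw [real_inner_comm]; exact ejk
  have hne_ij : i ≠ j := index_ne_of_dist_eq_one hij
  have hne_ik : i ≠ k := index_ne_of_dist_eq_one hik
  have hne_jk : j ≠ k := index_ne_of_dist_eq_one hjk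
  -- the normal
  set n : EuclideanSpace ℝ (Fin 3) := (1 / 2 : ℝ) • (gapDir c i + gapDir c j + gapDir c k) with hn
  have hni : ∀ m : Fin 14, ⟪n, gapDir c m⟫_ℝ =
      (⟪gapDir c i, gapDir c m⟫_ℝ + ⟪gapDir c j, gapDir c m⟫_ℝ + ⟪gapDir c k, gapDir c m⟫_ℝ) / 2 := by
    intro m
    rw [hn, real_inner_smul_left, inner_add_left, inner_add_left]
    ring
  have hself : ∀ m : Fin 14, m ≠ 0 → ⟪gapDir c m, gapDir c m⟫_ℝ = 1 := fun m hm0 => by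
    rw [real_inner_self_eq_norm_sq, hc.norm_gapDir hm0, one_pow]
  have h1i : ⟪n, gapDir c i⟫_ℝ = 1 := by rw [hni, hself i hi0, eji, eki]; norm_num
  have h1j : ⟪n, gapDir c j⟫_ℝ = 1 := by rw [hni, eij, hself j hj0, ekj]; norm_num
  have h1k : ⟪n, gapDir c k⟫_ℝ = 1 := by rw [hni, eik, ejk, hself k hk0]; norm_num
  -- every other direction is strictly below the facet plane
  have hlt : ∀ m : Fin 14, m ≠ 0 → m ≠ i → m ≠ j → m ≠ k → ⟪n, gapDir c m⟫_ℝ < 1 := by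
    intro m hm0 hmi hmj hmk
    rw [hni]
    have b1 := hc.inner_gapDir_le hi0 hm0 (Ne.symm hmi)
    have b2 := hc.inner_gapDir_le hj0 hm0 (Ne.symm hmj)
    have b3 := hc.inner_gapDir_le hk0 hm0 (Ne.symm hmk)
    by_cases hm13 : m = 13
    · subst hm13
      rw [tightLevel_of_right] at b1 b2 b3
      linarith
    · rw [tightLevel_of_ne hi13 hm13] at b1
      rw [tightLevel_of_ne hj13 hm13] at b2
      rw [tightLevel_of_ne hk13 hm13] at b3
      linarith
  have hle : ∀ y ∈ dirSet c, ⟪n, y⟫_ℝ ≤ 1 := by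
    intro y hy
    obtain ⟨m, hm0, rfl⟩ := mem_dirSet.1 hy
    by_cases hmi : m = i
    · rw [hmi, h1i]
    by_cases hmj : m = j
    · rw [hmj, h1j]
    by_cases hmk : m = k
    · rw [hmk, h1k]
    exact (hlt m hm0 hmi hmj hmk).le
  -- the tight set is exactly the triangle
  have htight : tightSet (dirSet c) n = {gapDir c i, gapDir c j, gapDir c k} := by
    ext y
    rw [mem_tightSet_dirSet_iff, mem_insert, mem_insert, mem_singleton]
    constructor
    · rintro ⟨m, hm0, rfl, hm1⟩
      by_contra hne
      rw [not_or, not_or] at hne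
      have hmi : m ≠ i := fun e => hne.1 (by rw [e])
      have hmj : m ≠ j := fun e => hne.2.1 (by rw [e])
      have hmk : m ≠ k := fun e => hne.2.2 (by rw [e])
      exact (hlt m hm0 hmi hmj hmk).ne hm1
    · rintro (rfl | rfl | rfl)
      · exact ⟨i, hi0, rfl, h1i⟩
      · exact ⟨j, hj0, rfl, h1j⟩
      · exact ⟨k, hk0, rfl, h1k⟩
  -- non-degenerate: `orient3² = 1/2`
  have hO : orient3 (gapDir c i) (gapDir c j) (gapDir c k) ≠ 0 := by
    intro h0
    have hsq := orient3_sq_of_unit (hc.norm_gapDir hi0) (hc.norm_gapDir hj0) (hc.norm_gapDir hk0)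
    rw [h0, eij, ejk, eki, eik] at hsq
    norm_num at hsq
  have hfacet : IsFacetNormal (dirSet c) n := by
    refine ⟨hle, ?_⟩
    rw [htight, coe_insert, coe_insert, coe_singleton]
    exact span_triple_eq_top_of_orient3_ne_zero hO
  have hcard : (tightSet (dirSet c) n).card = 3 := by
    have hD2 : intruderDist c < 2 := by linarith
    rw [htight, card_insert_of_notMem, card_pair (hc.gapDir_ne hD2 hj0 hk0 hne_jk)]
    rw [mem_insert, mem_singleton, not_or]
    exact ⟨hc.gapDir_ne hD2 hi0 hj0 hne_ij, hc.gapDir_ne hD2 hi0 hk0 hne_ik⟩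
  rw [← htight]
  exact mem_fanTriSets_of_card_tightSet_eq_three hX1 hfacet hcard

/-- **The p-triangle is a facet, hence a fan triangle** (`D < 3/2`): for two touching shell balls
`i, j` both touching the intruder, `{p, u_i, u_j} ∈ fanTriSets (dirSet c)` (`p = gapDir c 13`). -/
theorem IsGapConfig.pTriangle_mem_fanTriSets (hc : IsGapConfig c) (hD : intruderDist c < 3 / 2)
    {i j : Fin 14} (hi0 : i ≠ 0) (hi13 : i ≠ 13) (hj0 : j ≠ 0) (hj13 : j ≠ 13)
    (hij : dist (c i) (c j) = 1) (hi : dist (c i) (c 13) = 1) (hj : dist (c j) (c 13) = 1) :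
    ({gapDir c 13, gapDir c i, gapDir c j} : Finset (EuclideanSpace ℝ (Fin 3))) ∈
      fanTriSets (dirSet c) := by
  have hX1 := hc.norm_of_mem_dirSet
  have h13 : (13 : Fin 14) ≠ 0 := by decide
  set t : ℝ := intruderDist c / 2 with ht
  have ht1 : 1 / 2 ≤ t := by rw [ht]; linarith [hc.one_le_intruderDist]
  have ht2 : t < 3 / 4 := by rw [ht]; linarith
  have eij : ⟪gapDir c i, gapDir c j⟫_ℝ = 1 / 2 := by
    rw [hc.inner_gapDir_eq hi0 hj0 hij, tightLevel_of_ne hi13 hj13]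
  have epi : ⟪gapDir c 13, gapDir c i⟫_ℝ = t := by
    rw [real_inner_comm, hc.inner_gapDir_eq hi0 h13 hi, tightLevel_of_right]
  have epj : ⟪gapDir c 13, gapDir c j⟫_ℝ = t := by
    rw [real_inner_comm, hc.inner_gapDir_eq hj0 h13 hj, tightLevel_of_right]
  have eji : ⟪gapDir c j, gapDir c i⟫_ℝ = 1 / 2 := by rw [real_inner_comm]; exact eij
  have eip : ⟪gapDir c i, gapDir c 13⟫_ℝ = t := by rw [real_inner_comm]; exact epi
  have ejp : ⟪gapDir c j, gapDir c 13⟫_ℝ = t := by rw [real_inner_comm]; exact epj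
  have hne_ij : i ≠ j := index_ne_of_dist_eq_one hij
  have hself : ∀ m : Fin 14, m ≠ 0 → ⟪gapDir c m, gapDir c m⟫_ℝ = 1 := fun m hm0 => by
    rw [real_inner_self_eq_norm_sq, hc.norm_gapDir hm0, one_pow]
  -- the normal `α (u_i + u_j) + β p`
  have hden : 0 < 3 / 2 - 2 * t ^ 2 := by nlinarith
  set α : ℝ := (1 - t) / (3 / 2 - 2 * t ^ 2) with hα
  set β : ℝ := (3 / 2 - 2 * t) / (3 / 2 - 2 * t ^ 2) with hβ
  have hαpos : 0 < α := by rw [hα]; exact div_pos (by linarith) hden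
  have hβpos : 0 < β := by rw [hβ]; exact div_pos (by linarith) hden
  set n : EuclideanSpace ℝ (Fin 3) := α • (gapDir c i + gapDir c j) + β • gapDir c 13 with hn
  have hni : ∀ m : Fin 14, ⟪n, gapDir c m⟫_ℝ =
      α * (⟪gapDir c i, gapDir c m⟫_ℝ + ⟪gapDir c j, gapDir c m⟫_ℝ) + β * ⟪gapDir c 13, gapDir c m⟫_ℝ := by
    intro m
    rw [hn, inner_add_left, real_inner_smul_left, real_inner_smul_left, inner_add_left]
  have key1 : α * (1 + 1 / 2) + β * t = 1 := by
    rw [hα, hβ, div_mul_eq_mul_div, div_mul_eq_mul_div, ← add_div, div_eq_one_iff_eq hden.ne']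
    ring
  have key2 : α * (t + t) + β * 1 = 1 := by
    rw [hα, hβ, div_mul_eq_mul_div, div_mul_eq_mul_div, ← add_div, div_eq_one_iff_eq hden.ne']
    ring
  have key3 : α * (1 / 2 + 1 / 2) + β * t < 1 := by
    rw [hα, hβ, div_mul_eq_mul_div, div_mul_eq_mul_div, ← add_div, div_lt_one hden]
    nlinarith
  have h1i : ⟪n, gapDir c i⟫_ℝ = 1 := by rw [hni, hself i hi0, eji, epi]; exact key1
  have h1j : ⟪n, gapDir c j⟫_ℝ = 1 := by
    rw [hni, eij, hself j hj0, epj, add_comm (1 / 2 : ℝ) 1]; exact key1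
  have h1p : ⟪n, gapDir c 13⟫_ℝ = 1 := by rw [hni, eip, ejp, hself 13 h13]; exact key2
  have hlt : ∀ m : Fin 14, m ≠ 0 → m ≠ i → m ≠ j → m ≠ 13 → ⟪n, gapDir c m⟫_ℝ < 1 := by
    intro m hm0 hmi hmj hm13
    rw [hni]
    have b1 := hc.inner_gapDir_le hi0 hm0 (Ne.symm hmi)
    have b2 := hc.inner_gapDir_le hj0 hm0 (Ne.symm hmj)
    have b3 := hc.inner_gapDir_le h13 hm0 (Ne.symm hm13)
    rw [tightLevel_of_ne hi13 hm13] at b1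
    rw [tightLevel_of_ne hj13 hm13] at b2
    rw [tightLevel_of_left, ← ht] at b3
    have : α * (⟪gapDir c i, gapDir c m⟫_ℝ + ⟪gapDir c j, gapDir c m⟫_ℝ) +
        β * ⟪gapDir c 13, gapDir c m⟫_ℝ ≤ α * (1 / 2 + 1 / 2) + β * t := by
      have := mul_le_mul_of_nonneg_left (add_le_add b1 b2) hαpos.le
      have := mul_le_mul_of_nonneg_left b3 hβpos.le
      linarith
    linarith
  have hle : ∀ y ∈ dirSet c, ⟪n, y⟫_ℝ ≤ 1 := by
    intro y hy
    obtain ⟨m, hm0, rfl⟩ := mem_dirSet.1 hy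
    by_cases hmi : m = i
    · rw [hmi, h1i]
    by_cases hmj : m = j
    · rw [hmj, h1j]
    by_cases hm13 : m = 13
    · rw [hm13, h1p]
    exact (hlt m hm0 hmi hmj hm13).le
  have htight : tightSet (dirSet c) n = {gapDir c 13, gapDir c i, gapDir c j} := by
    ext y
    rw [mem_tightSet_dirSet_iff, mem_insert, mem_insert, mem_singleton]
    constructor
    · rintro ⟨m, hm0, rfl, hm1⟩
      by_contra hne
      rw [not_or, not_or] at hne
      have hm13 : m ≠ 13 := fun e => hne.1 (by rw [e])
      have hmi : m ≠ i := fun e => hne.2.1 (by rw [e])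
      have hmj : m ≠ j := fun e => hne.2.2 (by rw [e])
      exact (hlt m hm0 hmi hmj hm13).ne hm1
    · rintro (rfl | rfl | rfl)
      · exact ⟨13, h13, rfl, h1p⟩
      · exact ⟨i, hi0, rfl, h1i⟩
      · exact ⟨j, hj0, rfl, h1j⟩
  have hO : orient3 (gapDir c 13) (gapDir c i) (gapDir c j) ≠ 0 := by
    intro h0
    have hsq := orient3_sq_of_unit (hc.norm_gapDir h13) (hc.norm_gapDir hi0) (hc.norm_gapDir hj0)
    rw [h0, epi, eij, ejp, epj] at hsq
    nlinarith
  have hfacet : IsFacetNormal (dirSet c) n := by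
    refine ⟨hle, ?_⟩
    rw [htight, coe_insert, coe_insert, coe_singleton]
    exact span_triple_eq_top_of_orient3_ne_zero hO
  have hcard : (tightSet (dirSet c) n).card = 3 := by
    have hD2 : intruderDist c < 2 := by linarith
    rw [htight, card_insert_of_notMem, card_pair (hc.gapDir_ne hD2 hi0 hj0 hne_ij)]
    rw [mem_insert, mem_singleton, not_or]
    exact ⟨hc.gapDir_ne hD2 h13 hi0 (Ne.symm hi13), hc.gapDir_ne hD2 h13 hj0 (Ne.symm hj13)⟩
  rw [← htight]
  exact mem_fanTriSets_of_card_tightSet_eq_three hX1 hfacet hcard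

end Config

end Summit.Ventures.Crystal3D

end
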